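import Mathlib
import Summits.MatrixMultiplication.MatrixMultiplication.Theses.SnSubsetDichotomy

/-!
# Skeleton line `sidon-regime-hereditary-density` for crux `NoThresholdSubsetTriple`
(stmt-MatrixMultiplication-8302)

Route `SnSubsetDichotomy`, crux (rank 0, the route's NEGATIVE SIDE `¬ThresholdSubsetTriples`)
`NoThresholdSubsetTriple =
  ∃ c > 0, ∃ n₀, ∀ n ≥ n₀, ∀ S T U ⊆ S_n with the TPP, |S||T||U| ≤ (n!)^{3/2} · e^{-c√n}`
(BCCGU17 arXiv:1712.02302 §6's negative-direction target for SUBSETS; open problem).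

## The line (idea card `sidon-regime-hereditary-density`, crux-ideate r1 ideator 1; triage r1: 3 × pass
with doubts "half a dichotomy — state the complementary regime explicitly")

OBJECTS.  For a finite set `X` in a group: the (self-)difference set `D_X = X·X⁻¹ ∖ {1}`
(`diffSet`), the representation count `r_X(g) = #{x ∈ X : g·x ∈ X} = |X ∩ gX|` of `g` as a
quotient `s s'⁻¹` (`overlap`), and the translate self-overlap `m(X) = max_{g ≠ 1} r_X(g)`
(`selfOverlap`).  On `S_n`, `X` is `K'`-SPREADABLE (`Spreadable`) if it has a sub-set `X₀` with
`|X| ≤ e^{K'√n}|X₀|` and `m(X₀) ≤ e^{K'√n}` (a large "Sidon-like" core); the negation — EVERY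
subset of `X` of relative size `≥ e^{-K'√n}` has an `e^{K'√n}`-popular left translate — is the
robust "non-spread = partially periodic" regime (subgroups, cosets, `B(M_i)`, Young-type sets all
live there: for `X₀ ⊆ H₀` with `2|X₀| ≥ |H₀|`, `m(X₀) ≥ |X₀|/2 - 1`).

THE MECHANISM (spread regime).  (1) FIRST LEMMA (PROVED below, `diffSets_of_tpp`): for a TPP
triple with all three sets non-empty, `D_S, D_T, D_U` are pairwise disjoint and the ordered triple
is product-free (`d₁ d₂ d₃ ≠ 1`); they are symmetric and miss `1` by construction.  [The ideator's
`iff`-form is false without non-emptiness: `S = T = {1, g}`, `U = ∅` is TPP with `D_S = D_T`; the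
composition only needs this direction, and empty sets have volume `0`.]  (2) HD COUNT
(`stub_hdCount`, provable now): `|X|² ≤ [G:H]·(|X| + m(X)·|D_X ∩ H|)` for every subgroup `H`
(Cauchy–Schwarz over right cosets + fibre count) — so a spread set of size `≈ √(n!)` has a
difference set of relative density `≥ e^{-O(√n)}` inside EVERY subgroup of order `≥ √(n!)e^{O(√n)}`
("hereditarily dense", HD).  (3) THE TARGET `C⁺_HD` (`stub_noHDProductFreeTriple`, open): three
symmetric, pairwise disjoint subsets of `S_n ∖ 1` that are HD at rate `e^{-K√n}` always contain a
solution of `d₁ d₂ d₃ = 1`.  (4) TRANSFER (`stub_spreadTransfer`, provable now): (2)+(3)+first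
lemma+packing ⇒ TPP triples with three spreadable sets are sub-threshold for EVERY `c > 0`.
THE COMPLEMENT (`stub_nonSpreadBranch`, open, HARDEST, not attacked by this line): TPP triples in
which some set is robustly non-spread are sub-threshold — the crux on the structured regime, with
the structure (popular translates at every scale `≥ e^{-K'√n}|X|`) as hypothesis; it contains the
subgroup / hyperoctahedral / Young cases of routes `SnThresholdCensus` and `SnSubsetDichotomy`
(ranks 4–5) and is where census-type and BSG-type tools plug in.

`NoThresholdSubsetTriple_of` composes the four stubs into the crux BY NAME (kernel-checked, no
`sorry`): case split on "all three sets `K'`-spreadable".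

## Disproof used (cdisprove `Disproof.lean` v6, 2026-08-15T22:52Z, 1027 lines rc 0 — known here
through its evidence notes only: `run/gate/evidence/**` is not mounted in planner/triage jails and
`ledger crux cat … Disproof.lean` answers "no crux workfile")
* `false_without_TPP` — HONOURED: the TPP is used (only) at the first lemma `diffSets_of_tpp`; with
  `S = T = U = S_n` the three difference sets coincide (`= S_n ∖ 1`) and disjointness fails at once.
* `holds_without_posConst` / `packing_bound` (the crux is TRUE at `c = 0`) — HONOURED: every stub
  conclusion keeps `c > 0`; the packing bound enters `stub_spreadTransfer` only to size the sets
  (the `card_gt/lt_of_threshold` shape of §8: threshold triples are balanced, each set in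
  `(√(n!)e^{-c√n}, √(n!)e^{c√n})`), never as the source of `c`.
* `false_without_n0` — HONOURED: all statements are `∃ n₀, ∀ n ≥ n₀`.
* `false_with_pairwise_only` (rooted hyperoctahedral stabilisers are pairwise-TPP at slack `n³`) —
  HONOURED: the line uses the genuine three-fold condition — product-freeness of the ORDERED TRIPLE
  `(D_S, D_T, D_U)` is the 3-fold TPP, pairwise disjointness alone is only the packing bound.
* `crux_holds_for_young_triples`, `hyperoctahedralSubsets_of_crux`, `polynomialSlack_of_crux` —
  consistent: Young / `B(M_i)` configurations are non-spread and sit inside `stub_nonSpreadBranch`,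
  flagged hardest.
* No `Negative/` lemma has landed for this crux (nothing to import); `ledger negatives --problem
  MatrixMultiplication` = 3 statements (stmt-9732, stmt-9721 AlgebraicSTPPDichotomy designs;
  stmt-8036 DesignFlattening), none about `S_n`; no stub is an instance of any of them.
-/

set_option linter.dupNamespace false

noncomputable section

open scoped Classical
open Finset
open Literature.Combinatorics.Additive
open Summit.MatrixMultiplication.MatrixMultiplication.Theses.SnSubsetDichotomy

namespace Summit.MatrixMultiplication.MatrixMultiplication.Cruxes.NoThresholdSubsetTriple.SidonRegimeHereditaryDensity

/-! ### The objects: difference sets, representation counts, self-overlap -/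

section General

variable {G : Type*} [Group G] [DecidableEq G]

/-- The (self-)DIFFERENCE SET `D_X = X·X⁻¹ ∖ {1} = {s s'⁻¹ : s ≠ s' ∈ X}` of a finite set `X`
(right quotients, the convention of the tree's `TripleProductProperty`: `Q(X) = X X⁻¹`). -/
def diffSet (X : Finset G) : Finset G :=
  (Finset.image₂ (fun s s' => s * s'⁻¹) X X).erase 1

/-- The REPRESENTATION COUNT `r_X(g) = #{x ∈ X : g·x ∈ X} = |X ∩ g⁻¹X| = |gX ∩ X|` = the number of
ordered pairs `(s, s') ∈ X²` with `s s'⁻¹ = g` (`s = g s'`). -/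
def overlap (g : G) (X : Finset G) : ℕ :=
  (X.filter fun x => g * x ∈ X).card

/-- The TRANSLATE SELF-OVERLAP `m(X) = max_{g ≠ 1} r_X(g) = max_{g ≠ 1} |X ∩ gX|` (the dichotomy
parameter of the idea card: `m(X) ≤ e^{K√n}` is the spread / "Sidon" regime, `m(X) = |X|` for a
subgroup). -/
def selfOverlap [Fintype G] (X : Finset G) : ℕ :=
  ((Finset.univ : Finset G).erase 1).sup fun g => overlap g X

theorem mem_diffSet {X : Finset G} {d : G} :
    d ∈ diffSet X ↔ d ≠ 1 ∧ ∃ s ∈ X, ∃ s' ∈ X, s * s'⁻¹ = d := by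
  simp only [diffSet, Finset.mem_erase, Finset.mem_image₂]

/-- `1 ∉ D_X`. -/
theorem one_not_mem_diffSet (X : Finset G) : (1 : G) ∉ diffSet X := by
  simp [mem_diffSet]

/-- `D_X` is symmetric. -/
theorem inv_mem_diffSet {X : Finset G} {d : G} (h : d ∈ diffSet X) : d⁻¹ ∈ diffSet X := by
  rw [mem_diffSet] at h ⊢
  obtain ⟨hd, s, hs, s', hs', rfl⟩ := h
  refine ⟨?_, s', hs', s, hs, by group⟩
  rwa [Ne, inv_eq_one]

/-- Every `r_X(g)`, `g ≠ 1`, is at most `m(X)`. -/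
theorem overlap_le_selfOverlap [Fintype G] {X : Finset G} {g : G} (hg : g ≠ 1) :
    overlap g X ≤ selfOverlap X :=
  Finset.le_sup (f := fun g => overlap g X) (Finset.mem_erase.2 ⟨hg, Finset.mem_univ g⟩)

/-- `m(X) ≤ |X|`. -/
theorem selfOverlap_le_card [Fintype G] (X : Finset G) : selfOverlap X ≤ X.card :=
  Finset.sup_le fun _ _ => Finset.card_filter_le _ _

/-- An element with a positive representation count other than `1` lies in `D_X`. -/
theorem mem_diffSet_of_overlap_pos {X : Finset G} {g : G} (hg : g ≠ 1) (h : 0 < overlap g X) :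
    g ∈ diffSet X := by
  obtain ⟨x, hx⟩ := Finset.card_pos.1 h
  rw [Finset.mem_filter] at hx
  exact mem_diffSet.2 ⟨hg, g * x, hx.2, x, hx.1, by group⟩

/-! ### First lemma (PROVED): TPP ⟹ the three difference sets are pairwise disjoint and the
ordered triple is product-free -/

/-- Product-freeness of `(D_S, D_T, D_U)` is the TPP read on non-trivial quotients. -/
theorem productFree_of_tpp {S T U : Finset G} (h : TripleProductProperty S T U) :
    ∀ d₁ ∈ diffSet S, ∀ d₂ ∈ diffSet T, ∀ d₃ ∈ diffSet U, d₁ * d₂ * d₃ ≠ 1 := by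
  intro d₁ h₁ d₂ h₂ d₃ h₃ he
  rw [mem_diffSet] at h₁ h₂ h₃
  obtain ⟨hd₁, s, hs, s', hs', rfl⟩ := h₁
  obtain ⟨-, t, ht, t', ht', rfl⟩ := h₂
  obtain ⟨-, u, hu, u', hu', rfl⟩ := h₃
  obtain ⟨rfl, -, -⟩ := h s hs s' hs' t ht t' ht' u hu u' hu' he
  exact hd₁ (mul_inv_cancel _)

/-- `D_S ∩ D_T = ∅` under the TPP, provided `U ≠ ∅` (take `q_U = 1`). -/
theorem disjoint_diffSet_ST_of_tpp {S T U : Finset G} (h : TripleProductProperty S T U)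
    (hU : U.Nonempty) : Disjoint (diffSet S) (diffSet T) := by
  rw [Finset.disjoint_left]
  intro d h₁ h₂
  rw [mem_diffSet] at h₁ h₂
  obtain ⟨hd, s, hs, s', hs', rfl⟩ := h₁
  obtain ⟨-, t, ht, t', ht', he⟩ := h₂
  obtain ⟨u, hu⟩ := hU
  have key : s * s'⁻¹ * (t' * t⁻¹) * (u * u⁻¹) = 1 := by
    rw [← he]; group
  obtain ⟨rfl, -, -⟩ := h s hs s' hs' t' ht' t ht u hu u hu key
  exact hd (mul_inv_cancel _)

/-- `D_T ∩ D_U = ∅` under the TPP, provided `S ≠ ∅`. -/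
theorem disjoint_diffSet_TU_of_tpp {S T U : Finset G} (h : TripleProductProperty S T U)
    (hS : S.Nonempty) : Disjoint (diffSet T) (diffSet U) := by
  rw [Finset.disjoint_left]
  intro d h₁ h₂
  rw [mem_diffSet] at h₁ h₂
  obtain ⟨hd, t, ht, t', ht', rfl⟩ := h₁
  obtain ⟨-, u, hu, u', hu', he⟩ := h₂
  obtain ⟨s, hs⟩ := hS
  have key : s * s⁻¹ * (t * t'⁻¹) * (u' * u⁻¹) = 1 := by
    rw [← he]; group
  obtain ⟨-, rfl, -⟩ := h s hs s hs t ht t' ht' u' hu' u hu key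
  exact hd (mul_inv_cancel _)

/-- `D_U ∩ D_S = ∅` under the TPP, provided `T ≠ ∅`. -/
theorem disjoint_diffSet_US_of_tpp {S T U : Finset G} (h : TripleProductProperty S T U)
    (hT : T.Nonempty) : Disjoint (diffSet U) (diffSet S) := by
  rw [Finset.disjoint_left]
  intro d h₁ h₂
  rw [mem_diffSet] at h₁ h₂
  obtain ⟨hd, u, hu, u', hu', rfl⟩ := h₁
  obtain ⟨-, s, hs, s', hs', he⟩ := h₂
  obtain ⟨t, ht⟩ := hT
  have key : s' * s⁻¹ * (t * t⁻¹) * (u * u'⁻¹) = 1 := by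
    rw [← he]; group
  obtain ⟨-, -, rfl⟩ := h s' hs' s hs t ht t ht u hu u' hu' key
  exact hd (mul_inv_cancel _)

/-- FIRST LEMMA of the line (the direction the composition needs; pure algebra, PROVED): for a TPP
triple with all three sets non-empty, the difference sets `D_S, D_T, D_U` are pairwise disjoint and
the ordered triple is product-free. (They are symmetric and miss `1` for every `X`:
`inv_mem_diffSet`, `one_not_mem_diffSet`.) -/
theorem diffSets_of_tpp {S T U : Finset G} (h : TripleProductProperty S T U) (hS : S.Nonempty)
    (hT : T.Nonempty) (hU : U.Nonempty) :
    Disjoint (diffSet S) (diffSet T) ∧ Disjoint (diffSet T) (diffSet U) ∧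
      Disjoint (diffSet U) (diffSet S) ∧
        ∀ d₁ ∈ diffSet S, ∀ d₂ ∈ diffSet T, ∀ d₃ ∈ diffSet U, d₁ * d₂ * d₃ ≠ 1 :=
  ⟨disjoint_diffSet_ST_of_tpp h hU, disjoint_diffSet_TU_of_tpp h hS,
    disjoint_diffSet_US_of_tpp h hT, productFree_of_tpp h⟩

end General

/-! ### The dichotomy parameter on `S_n` -/

/-- `X ⊆ S_n` is `K'`-SPREADABLE: it contains a "Sidon-like core" `X₀` of relative size
`≥ e^{-K'√n}` whose translate self-overlap is at most `e^{K'√n}` (`m(X₀) ≤ e^{K'√n}`).  A random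
set of size `√(n!)e^{c√n}` has `m ≈ e^{2c√n}`, so `K'` is to be thought of as larger than the
slack constant; the robust negation "every subset of relative size `≥ e^{-K'√n}` has an
`e^{K'√n}`-popular left translate" is the structured regime (triage r1-3's objection to the bare
`m(X)`: `e^{K'√n}` stray pairs no longer flip the regime). -/
def Spreadable (K' : ℝ) (n : ℕ) (X : Finset (Equiv.Perm (Fin n))) : Prop :=
  ∃ X₀ : Finset (Equiv.Perm (Fin n)), X₀ ⊆ X ∧
    (X.card : ℝ) ≤ Real.exp (K' * Real.sqrt (n : ℝ)) * (X₀.card : ℝ) ∧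
      (selfOverlap X₀ : ℝ) ≤ Real.exp (K' * Real.sqrt (n : ℝ))

/-! ### The four stub STATEMENTS (named `Prop`s; the registered `stub_*` theorems below restate
them verbatim, and `Registered.stub_*` are their name-keyed aliases used as the hypotheses of
`NoThresholdSubsetTriple_of` — same device as `Cruxes/MazurKaneLaw/Lines/fibre-toolkit-lp-wall-map.lean`) -/

/-- Statement of STUB 1 — the HEREDITARY-DENSITY COUNT (any finite group): the ordered pairs of
`X` lying in a common right coset of `H` number at least `|X|²/[G:H]` (Cauchy–Schwarz over the
`[G:H]` right cosets); `|X|` of them are diagonal and each off-diagonal one has quotient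
`s s'⁻¹ ∈ D_X ∩ H` with fibre size `r_X(s s'⁻¹) ≤ m(X)`.  Hence
`|X|² ≤ [G:H] · (|X| + m(X) · |D_X ∩ H|)`, i.e. `D_X` has relative density
`≥ (|X|²|H|/|G| − |X|) / (m(X)|H|)` in `H`. -/
def HDCount : Prop :=
  ∀ (G : Type) [Group G] [Fintype G] [DecidableEq G] (H : Subgroup G) (X : Finset G),
    X.card ^ 2 ≤ H.index * (X.card + selfOverlap X * ((diffSet X).filter (· ∈ H)).card)

/-- Statement of STUB 3 — THE TARGET `C⁺_HD` (idea card `NoHereditarilyDenseProductFreeTriple`):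
for every `K > 0` and `n ≥ n₀(K)`, three SYMMETRIC subsets `D₀, D₁, D₂ ⊆ S_n ∖ {1}`, pairwise
DISJOINT, each of relative density `≥ e^{-K√n}` inside EVERY subgroup `H ≤ S_n` of order
`≥ √(n!)·e^{K√n}` (hereditarily dense), contain a solution of `d₀ d₁ d₂ = 1` (`dᵢ ∈ Dᵢ`).
Membership in `H` is filtered with the classical decidability instance (`open scoped Classical`),
as everywhere in this file and in the route file. -/
def NoHDProductFreeTriple : Prop :=
  ∀ K : ℝ, 0 < K → ∃ n₀ : ℕ, ∀ n ≥ n₀, ∀ D : Fin 3 → Finset (Equiv.Perm (Fin n)),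
    (∀ i, ∀ d ∈ D i, d⁻¹ ∈ D i) → (∀ i, (1 : Equiv.Perm (Fin n)) ∉ D i) →
      (∀ i j, i ≠ j → Disjoint (D i) (D j)) →
        (∀ i, ∀ H : Subgroup (Equiv.Perm (Fin n)),
            Real.sqrt (n.factorial : ℝ) * Real.exp (K * Real.sqrt (n : ℝ)) ≤ (Nat.card H : ℝ) →
              Real.exp (-(K * Real.sqrt (n : ℝ))) * (Nat.card H : ℝ) ≤
                (((D i).filter (· ∈ H)).card : ℝ)) →
          ∃ d₁ ∈ D 0, ∃ d₂ ∈ D 1, ∃ d₃ ∈ D 2, d₁ * d₂ * d₃ = 1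

/-- Statement of STUB 2 — the TRANSFER `C⁺_HD → crux on the spread regime` ("Sidon-ification
bookkeeping"): given the HD count and `C⁺_HD`, for every `K' > 0` and EVERY `c > 0`, TPP triples in
`S_n` (`n ≥ n₀(K', c)`) all three of whose sets are `K'`-spreadable have
`|S||T||U| ≤ (n!)^{3/2}e^{-c√n}` — indeed no spreadable TPP triple beats any `e^{-c√n}`. -/
def SpreadTransfer : Prop :=
  HDCount → NoHDProductFreeTriple → ∀ K' : ℝ, 0 < K' → ∀ c : ℝ, 0 < c → ∃ n₀ : ℕ, ∀ n ≥ n₀,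
    ∀ S T U : Finset (Equiv.Perm (Fin n)), TripleProductProperty S T U →
      Spreadable K' n S → Spreadable K' n T → Spreadable K' n U →
        ((S.card * T.card * U.card : ℕ) : ℝ) ≤
          (n.factorial : ℝ) ^ ((3 : ℝ) / 2) * Real.exp (-(c * Real.sqrt (n : ℝ)))

/-- Statement of STUB 4 — the NON-SPREAD (STRUCTURED) BRANCH, open, HARDEST: for some `K' > 0`,
TPP triples in `S_n` in which some set is NOT `K'`-spreadable (every subset of relative size
`≥ e^{-K'√n}` has a left translate `g ≠ 1` with `|X₀ ∩ gX₀| > e^{K'√n}`) are sub-threshold for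
some `c > 0`. -/
def NonSpreadBranch : Prop :=
  ∃ K' : ℝ, 0 < K' ∧ ∃ c : ℝ, 0 < c ∧ ∃ n₀ : ℕ, ∀ n ≥ n₀,
    ∀ S T U : Finset (Equiv.Perm (Fin n)), TripleProductProperty S T U →
      (¬ Spreadable K' n S ∨ ¬ Spreadable K' n T ∨ ¬ Spreadable K' n U) →
        ((S.card * T.card * U.card : ℕ) : ℝ) ≤
          (n.factorial : ℝ) ^ ((3 : ℝ) / 2) * Real.exp (-(c * Real.sqrt (n : ℝ)))

/-! ### The registered stubs -/

/-- STUB 1 (M, provable now) — HEREDITARY-DENSITY COUNT in any finite group: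
`|X|² ≤ [G:H] · (|X| + m(X) · |D_X ∩ H|)`.
Proof route: let `C` run over the `[G:H]` right cosets of `H` (`Subgroup.index`, finitely many) and
`a_C = |X ∩ C|`; `Σ a_C = |X|` and `Σ a_C² = #{(s,s') ∈ X² : s s'⁻¹ ∈ H}` (same right coset iff
`s s'⁻¹ ∈ H`); discrete Cauchy–Schwarz (`sq_sum_le_card_mul_sum_sq`) gives
`|X|² ≤ [G:H] · #{(s,s') : s s'⁻¹ ∈ H}`; split the pairs into the `|X|` diagonal ones and, for each
`d ∈ D_X ∩ H`, the fibre `{(s,s') : s s'⁻¹ = d}` of size `r_X(d) = overlap d X ≤ selfOverlap X`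
(`overlap_le_selfOverlap`, `mem_diffSet_of_overlap_pos`). Equivalent real form used downstream:
`|D_X ∩ H| ≥ (|X|²·|H|/|G| − |X|)/m(X)` (`Subgroup.index_mul_card`). Why it might need care: only
Finset bookkeeping (the pair set as `(X ×ˢ X).filter`, `Finset.card_eq_sum_card_fiberwise`).
Size M (~150 lines). Leans on: Mathlib `Subgroup.index_mul_card`, `sq_sum_le_card_mul_sum_sq`,
`Finset.card_eq_sum_card_fiberwise`, `QuotientGroup` right cosets (or `Subgroup.op` orbits). -/
theorem stub_hdCount :
    ∀ (G : Type) [Group G] [Fintype G] [DecidableEq G] (H : Subgroup G) (X : Finset G),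
      X.card ^ 2 ≤ H.index * (X.card + selfOverlap X * ((diffSet X).filter (· ∈ H)).card) := by
  sorry

/-- STUB 2 (L, provable now) — THE TRANSFER (Sidon-ification): `HDCount → C⁺_HD →` for all
`K' > 0`, `c > 0` there is `n₀` beyond which no TPP triple with three `K'`-spreadable sets has
`|S||T||U| > (n!)^{3/2}e^{-c√n}`.
Proof route (all arithmetic at scale `e^{Θ(√n)}`): suppose `vol > (n!)^{3/2}e^{-c√n}` and let
`S₀, T₀, U₀` be the spread cores (`|X| ≤ e^{K'√n}|X₀|`, `m(X₀) ≤ e^{K'√n}`). (i) `(S₀,T₀,U₀)` is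
TPP (`TripleProductProperty.mono`) with `vol₀ ≥ vol·e^{-3K'√n} > (n!)^{3/2}e^{-c₁√n}`,
`c₁ := c + 3K'`; in particular all three are non-empty. (ii) PACKING (`RealizesTPP.mul_le_card`:
`|S₀||T₀| ≤ n!` and cyclically; Disproof §8 `card_gt/lt_of_threshold` is the same computation):
each `|X₀| > vol₀/n! > √(n!)e^{-c₁√n}`. (iii) HD via STUB 1: for a subgroup `H` with
`|H| ≥ √(n!)e^{K√n}`, `|X₀||H|/n! > e^{(K-c₁)√n} ≥ 2` (if `K ≥ c₁ + 1`), so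
`|X₀|²|H|/n! − |X₀| ≥ |X₀|²|H|/(2·n!) > e^{-2c₁√n}|H|/2`, and dividing STUB 1 by
`m(X₀) ≤ e^{K'√n}`: `|D_{X₀} ∩ H| ≥ e^{-(2c₁+K')√n}|H|/2 ≥ e^{-K√n}|H|` for
`K := 2c₁ + K' + 1 = 2c + 7K' + 1` (uses `e^{√n} ≥ 2`, i.e. `n ≥ 1`). (iv) The triple
`D := (D_{S₀}, D_{T₀}, D_{U₀})` is symmetric (`inv_mem_diffSet`), misses `1`
(`one_not_mem_diffSet`), is pairwise disjoint and product-free (`diffSets_of_tpp`), and HD at `K` by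
(iii); `C⁺_HD` at `K` yields, for `n ≥ n₀(K)`, `d₁d₂d₃ = 1` — contradiction. Hence
`vol ≤ (n!)^{3/2}e^{-c√n}` for `n ≥ max (n₀(K)) 1`. Honours `holds_without_posConst` (packing
only sizes the sets) and `false_with_pairwise_only` (product-freeness of the ordered triple is the
3-fold condition). Size L (~300 lines of `Real.exp`/`Real.sqrt`/`Nat.factorial` bookkeeping;
pattern: the route file's `closes`). Leans on: `stub_hdCount`, `diffSets_of_tpp`, tree
`Literature.Computability.AlgebraicComplexity.RealizesTPP.mul_le_card`,
`Literature.Combinatorics.Additive.TripleProductProperty.mono`, Mathlib `Subgroup.index_mul_card`,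
`Nat.card_eq_fintype_card`, `Fintype.card_perm`, `Real.exp_add`, `Real.exp_le_exp`,
`Real.add_one_le_exp`, `Real.sqrt_nonneg`, `Real.sq_sqrt`. -/
theorem stub_spreadTransfer :
    HDCount → NoHDProductFreeTriple → ∀ K' : ℝ, 0 < K' → ∀ c : ℝ, 0 < c → ∃ n₀ : ℕ, ∀ n ≥ n₀,
      ∀ S T U : Finset (Equiv.Perm (Fin n)), TripleProductProperty S T U →
        Spreadable K' n S → Spreadable K' n T → Spreadable K' n U →
          ((S.card * T.card * U.card : ℕ) : ℝ) ≤
            (n.factorial : ℝ) ^ ((3 : ℝ) / 2) * Real.exp (-(c * Real.sqrt (n : ℝ))) := by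
  sorry

/-- STUB 3 (XL, OPEN — the line's TARGET and its load-bearing bet) — `C⁺_HD`, NO HEREDITARILY
DENSE PRODUCT-FREE TRIPLE: for `K > 0` and `n ≥ n₀(K)`, symmetric pairwise-disjoint
`D₀, D₁, D₂ ⊆ S_n ∖ 1` with `|Dᵢ ∩ H| ≥ e^{-K√n}|H|` for every subgroup `|H| ≥ √(n!)e^{K√n}`
contain `d₀d₁d₂ = 1`.
Why plausibly true: the dense product-free configurations of `S_n` on record all die on HD — sign
classes vanish on `A_n`; dictator/Kedlaya sets `K_{x,I} = {σ : σ(x) ∈ I, σ(I) ∩ I = ∅}` (the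
route's O2 obstruction, product-free at density `e^{-K√n}`) vanish on `Stab(x)`, a subgroup of
order `(n-1)! ≫ √(n!)e^{K√n}`; the KL23 §7 sharpness family (two-block dictators) and the
Keevash–Lifshitz–Minzer extremisers (arXiv:2205.15191) are dictator-type, hence non-HD; flow
juntas `A→B→C↛A`, Hamming shells, bi-invariant-metric layers, normal sets, non-derangement
colourings all fail (three triage seats, ~25 min each, TRIAGE r1-1/2/3 §C). Why it might fail /
why it is hard: it is a mixing-to-zero statement for three dense sets at density `e^{-Θ(√n)}`,
below every published engine (KeevashLifshitz2023 arXiv:2307.15030 Thm 1.14 stops at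
`e^{-cn^{1/3}}` and is sharp in §7); HD is far stronger than globalness (density in `Stab_pw(F)` for
`|F|` up to `≈ n/2`) but no tool USES it at that depth yet; and HD at rate `e^{-K√n} ≪ 1/n` does not
exclude level-1 structure through the diagonal (`{σ ≠ 1 : σ(1) ∈ B ∨ σ⁻¹(1) ∈ B}`, `1 ∈ B`, has
density `≥ 1/n − 1/|H|` in every `H`; TRIAGE r1-2 (a)), so `C⁺_HD` is in substance an inverse
theorem for tricoloured product-free triples at density `e^{-Θ(√n)}`. Natural first bites: (a) the
model case where two colours hide in a common subgroup `L ≤ Y = S_A × S_B` of index `e^{K√n}` —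
HD of the third colour AT `L` closes the escape (card, "Why it bites" (3)); (b) induction over the
top of the subgroup lattice (large subgroups of `S_n` are Young-like: Praeger–Saxl / Maróti
`|H| ≤ 4ⁿ` for primitive `H ∌ A_n`); (c) the cheapest falsifier F1 of the card (kit local search at
`n = 8–10` for HD product-free symmetric disjoint triples with `D₃ ⊇` a derangement coset colour).
Sources: arXiv:2307.15030, arXiv:2205.15191, doi:10.19086/da.610, Kedlaya (AMM 105, 1998),
Gowers 2008 (quasirandom groups), BlasiakChurchCohnGrochowUmans2017 §5–6. -/
theorem stub_noHDProductFreeTriple :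
    ∀ K : ℝ, 0 < K → ∃ n₀ : ℕ, ∀ n ≥ n₀, ∀ D : Fin 3 → Finset (Equiv.Perm (Fin n)),
      (∀ i, ∀ d ∈ D i, d⁻¹ ∈ D i) → (∀ i, (1 : Equiv.Perm (Fin n)) ∉ D i) →
        (∀ i j, i ≠ j → Disjoint (D i) (D j)) →
          (∀ i, ∀ H : Subgroup (Equiv.Perm (Fin n)),
              Real.sqrt (n.factorial : ℝ) * Real.exp (K * Real.sqrt (n : ℝ)) ≤ (Nat.card H : ℝ) →
                Real.exp (-(K * Real.sqrt (n : ℝ))) * (Nat.card H : ℝ) ≤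
                  (((D i).filter (· ∈ H)).card : ℝ)) →
            ∃ d₁ ∈ D 0, ∃ d₂ ∈ D 1, ∃ d₃ ∈ D 2, d₁ * d₂ * d₃ = 1 := by
  sorry

/-- STUB 4 (XL⁺, OPEN, HARDEST — the complementary regime; NOT attacked by this line, recorded so
that the composition is honest about the crux's range) — THE NON-SPREAD (STRUCTURED) BRANCH: for
some `K' > 0` and `c > 0`, every TPP triple in `S_n` (`n ≥ n₀`) with a robustly non-spread set
(every subset `X₀ ⊆ X` with `|X| ≤ e^{K'√n}|X₀|` has `m(X₀) > e^{K'√n}`) satisfies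
`|S||T||U| ≤ (n!)^{3/2}e^{-c√n}`.
What the hypothesis buys (first provable move, the CHUNK LEMMA, not registered): greedily removing
popular fibres `F = {x ∈ X' : g x ∈ X'}` (`|F| > e^{K'√n}`) while `|X'| ≥ e^{-K'√n}|X|` shows that
`X ⊇ X₂ = ⋃ᵢ (Fᵢ ∪ gᵢFᵢ)` with `|X₂| ≥ |X|/2`, the `Fᵢ` disjoint, `gᵢ ≠ 1`, `r_{X₂}(gᵢ) > e^{K'√n}`
— every point of `X₂` sits on an exponentially popular difference, at every scale down to
`e^{-K'√n}|X|` (the hypothesis is hereditary for large subsets, so the extraction iterates); the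
prover may freely pass to sub-triples (`TripleProductProperty.mono`) and use `C⁺_HD` /
`stub_spreadTransfer` on any spreadable piece. Why plausibly true: it is implied by the crux; it
CONTAINS every near-threshold configuration on record — a subgroup `H₀` of order `≈ √(n!)` is
robustly non-spread (`m(X₀) ≥ |X₀|/2 − 1` for `X₀ ⊆ H₀`, `2|X₀| ≥ |H₀|`), so the stub implies the
one-subgroup case of `SnThresholdCensus.NoThresholdSubgroupTriple`, and the Young
(`crux_holds_for_young_triples`, BCCGU17 Thm 4.2 — TRUE there) and hyperoctahedral `B(M_i)`
configurations (route cruxes `HyperoctahedralSubsets` r4, `PolynomialSlack` r5 — OPEN there). Why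
it might fail / why it is hard: exactly the crux's recorded difficulty (BCCGU17 §4–5: no tool for
non-Young subsets; rooted matching stabilisers pairwise trivial at slack `n³`,
`false_with_pairwise_only`); the popular-translate structure at level `e^{K'√n}` is weak
(`e^{K'√n}/√(n!)` of the set per direction) and no Freiman/BSG-type theorem turns "richly periodic
at scale `e^{O(√n)}`" into "near a union of `e^{o(√n)}` cosets of a subgroup of order `≈ √(n!)`" in
`S_n` (BSG losses `poly(e^{K'√n}) = e^{O(√n)}` are affordable, the structure theory of
`e^{O(√n)}`-approximate subgroups of `S_n` at size `√(n!)` is not available: Helfgott–Seress-type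
growth results are far too weak). A threshold TPP family inside three `B(M_i)`
(`HyperoctahedralThreshold`, the route's deciding-side crux) refutes this stub and the crux
together (and gives `ω = 2` via `closes`). Sources: BlasiakChurchCohnGrochowUmans2017
arXiv:1712.02302 Thm 4.2 and §4–6, BlasiakCohnGrochowPrattUmans2023 arXiv:2204.03826 Thm 3.2 /
Rem 3.7, Tao 2008 (product set estimates for non-commutative groups), route file § Numbers. -/
theorem stub_nonSpreadBranch :
    ∃ K' : ℝ, 0 < K' ∧ ∃ c : ℝ, 0 < c ∧ ∃ n₀ : ℕ, ∀ n ≥ n₀,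
      ∀ S T U : Finset (Equiv.Perm (Fin n)), TripleProductProperty S T U →
        (¬ Spreadable K' n S ∨ ¬ Spreadable K' n T ∨ ¬ Spreadable K' n U) →
          ((S.card * T.card * U.card : ℕ) : ℝ) ≤
            (n.factorial : ℝ) ^ ((3 : ℝ) / 2) * Real.exp (-(c * Real.sqrt (n : ℝ))) := by
  sorry

/-! ### Consistency: each named statement IS its registered stub (definitionally) -/

theorem hdCount_holds : HDCount := stub_hdCount
theorem spreadTransfer_holds : SpreadTransfer := stub_spreadTransfer
theorem noHDProductFreeTriple_holds : NoHDProductFreeTriple := stub_noHDProductFreeTriple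
theorem nonSpreadBranch_holds : NonSpreadBranch := stub_nonSpreadBranch

/-! ### Name-keyed aliases of the four statements (the hypotheses of the composition) -/
namespace Registered

/-- Alias of `HDCount` keyed by the registered stub name. -/
abbrev stub_hdCount : Prop := HDCount
/-- Alias of `SpreadTransfer` keyed by the registered stub name. -/
abbrev stub_spreadTransfer : Prop := SpreadTransfer
/-- Alias of `NoHDProductFreeTriple` keyed by the registered stub name. -/
abbrev stub_noHDProductFreeTriple : Prop := NoHDProductFreeTriple
/-- Alias of `NonSpreadBranch` keyed by the registered stub name. -/
abbrev stub_nonSpreadBranch : Prop := NonSpreadBranch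

end Registered

/-! ### The composition: the four stubs imply the crux, by name -/

/-- `NoThresholdSubsetTriple` from the four stubs (pure logic; no `sorry`): take `K', c, n₄` from
the non-spread branch (STUB 4) and `n₂ = n₀(K', c)` from the transfer (STUB 2 fed with STUBS 1 and
3); for `n ≥ max n₂ n₄` and a TPP triple, either all three sets are `K'`-spreadable (STUB 2) or
one is not (STUB 4); both give `|S||T||U| ≤ (n!)^{3/2}e^{-c√n}` with the SAME `c` (the transfer
holds for every `c`, so no `min`/monotonicity arithmetic is needed here). -/
theorem NoThresholdSubsetTriple_of (h₁ : Registered.stub_hdCount)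
    (h₂ : Registered.stub_spreadTransfer) (h₃ : Registered.stub_noHDProductFreeTriple)
    (h₄ : Registered.stub_nonSpreadBranch) :
    Summit.MatrixMultiplication.MatrixMultiplication.Theses.SnSubsetDichotomy.NoThresholdSubsetTriple := by
  obtain ⟨K', hK', c, hc, n₄, h4⟩ := h₄
  obtain ⟨n₂, h2⟩ := h₂ h₁ h₃ K' hK' c hc
  refine ⟨c, hc, max n₂ n₄, fun n hn S T U hTPP => ?_⟩
  by_cases hsp : Spreadable K' n S ∧ Spreadable K' n T ∧ Spreadable K' n U
  · exact h2 n ((le_max_left n₂ n₄).trans hn) S T U hTPP hsp.1 hsp.2.1 hsp.2.2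
  · exact h4 n ((le_max_right n₂ n₄).trans hn) S T U hTPP (by simpa only [not_and_or] using hsp)

/-- Wiring check: the registered stubs feed `NoThresholdSubsetTriple_of` as stated. -/
example :
    Summit.MatrixMultiplication.MatrixMultiplication.Theses.SnSubsetDichotomy.NoThresholdSubsetTriple :=
  NoThresholdSubsetTriple_of stub_hdCount stub_spreadTransfer stub_noHDProductFreeTriple
    stub_nonSpreadBranch

end Summit.MatrixMultiplication.MatrixMultiplication.Cruxes.NoThresholdSubsetTriple.SidonRegimeHereditaryDensity

end
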